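/-
Copyright (c) 2026 the pub-hodgecm-mathlib formalisation cell (harness21).  Prover seat hodgecm-mathlib-K2E5-p12 (g2), Track B «K2-LIT» ∕ h413, deal (D19) of
K2E3-plan (g2) under the §L line lead K2E3-p12 (g3): FILE B (the CM head).  2026-09-04.
-/
import Summits.HodgeConjecture.HodgeConjecture.Theorems.K2E3U2LieDiagonalCoordinates               -- ★ FILE A p856741 (this seat): generic coordinates of `𝔲(σ, J)`, rank 2
import Summits.HodgeConjecture.HodgeConjecture.Theorems.K2E3DiagonalFormInvSqrtIntegrable           -- ★ p856569 (K2E3-p12 g3): `lintegral_piPrimePowBall_sqrt_normAbs_inv_lt_top`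
import Summits.HodgeConjecture.HodgeConjecture.Theorems.K2E3NormalizedCharBddNearSemisimpleRegular -- ★ p855019 (K2E3-p12 g0): `continuous_discr_charpoly`
import Literature.NumberTheory.Automorphic.QuadraticPlaceDescentPins                              -- ★ `galAdicCompletionMap_eq_self_iff_mem_range`, `exists_apply_eq_neg_ne_zero`; brings `quadraticLocalEquiv`, `toPlace`
import Literature.NumberTheory.Automorphic.AdicCompletionLocalField                               -- ★ `instIsNonarchimedeanLocalFieldAdicCompletion`
import Literature.NumberTheory.Automorphic.AdeleAddCharLocalNontrivial                            -- ★ `isContinuousNontrivial_adeleAddCharAt`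
import Literature.NumberTheory.Automorphic.AdicCompletionUniformizerResidueCardGlue               -- ★ `residueFieldCard_adicCompletion_eq_absNorm`
import Literature.NumberTheory.Automorphic.ProjectiveDescentLatticeLevelsDischarge                -- ★ `valued_toPlace_eq_pow_two_of_ramified`
import Literature.NumberTheory.Automorphic.Liu2021.LemD1AsPrintedIndexedNonVacuityTameSynthesis   -- ★ `isUnramifiedIn_of_ramificationIdx'_eq_one`
import Literature.NumberTheory.Automorphic.Liu2021.LemD1AsPrintedIndexedNonVacuityInertCofinite   -- ★ `valued_toPlace_of_isUnramifiedIn`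
import Literature.NumberTheory.Rogawski1990.FinExplicitTransferFactorInertPlaceValuation          -- ★ `absNorm_placesOver_eq_sq_of_nonsplit_of_isUnramifiedIn`
import Literature.NumberTheory.Rogawski1990.RankOneUnstableDeltaValueRamified                    -- ★ `absNorm_placesOver_eq_of_ramified`
import Literature.NumberTheory.Rogawski1990.UnitaryVertexStabilizerCoverCM                       -- ★ `placeForm_map_transpose_of_hermitian`
import Literature.NumberTheory.QuadraticForms.FiniteFieldHermitianCanonicalForm                   -- ★ `Hermitian.exists_congr_diagonal_of_involution`
import Mathlib.MeasureTheory.Measure.Haar.Unique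
import HarnessLib

/-!
# K2 ∕ E3, (D19) FILE B — `|disc χ_Y|_{L_w}^{-1∕4}` IS LOCALLY INTEGRABLE ON `𝔲₂(H_w)` AT A NON-SPLIT PLACE

Cell `pub/hodgecm-mathlib` (D-0151), Track B «K2-LIT», crux H413 = `stmt-HodgeConjecture-24833` (lane `--supports … --as helper`, count-neutral); seat K2E5-p12 (g2);
dealer K2E3-plan (g2) deal (D19) 2026-09-04T01:53:08Z; §L line lead K2E3-p12 (g3) (head shape «=» 02:00:20Z).  THEOREMS ONLY (no definition ∕ instance ∕ notation ∕
named fact ∕ `sorry`); never imports `Cruxes/…/Lines`.  The `N = 2` local-integrability input of the hosted socket (L-B_U)′ `sig_K2E3UNilpotentFourierRegular`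
(U12 SIGS ED. 7 :373, line `K2_E3_EllipticInputs`): the weight `η^{1∕2} = (√√|disc χ_Y|_{L_w})` of Harish-Chandra's Thm. 4.4 on `𝔲(σ_w, H_w)`, `[L_w : L⁺_v] = 2`.

SETTING.  `L` CM, `v` a finite place of `L⁺`, `w ∣ v` NON-SPLIT (`c • w = w`; inert or ramified, any residue characteristic), `L_w ⊃ ι(L⁺_v)` (`ι = toPlace v w =
algebraMap`), `σ_w = galAdicCompletionMap c hw`, `H ∈ M₂(L)` hermitian with `det H ≠ 0`, `H_w = placeForm H w`, `𝔲 = lieOfForm σ_w H_w` (★ `K2E3LieUnitaryDefs`), `μ𝔤` an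
additive Haar measure on `↥𝔲`.
* §1 `exists_quadraticCoordinates` — `L_w = ι(L⁺_v) ⊕ λ·ι(L⁺_v)` with CONTINUOUS coordinates (`λ = δ ∈ L`, `cδ = −δ ≠ 0`, `λ² = ι(δ²)`; ★ `quadraticLocalEquiv` read at the one
  place above `v` through Mathlib `Homeomorph.piUnique`).
* §2 `normAbs_toPlace_eq_sq` — **`|ι y|_{L_w} = |y|_{L⁺_v}²`** in both ramification cases (`e = 1`: `v_w ∘ ι = v_v`, `N𝔓_w = N𝔭_v²`; `e = 2`: `v_w ∘ ι = v_v²`, `N𝔓_w = N𝔭_v`).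
* §3 `exists_addEquiv_discr_eq` — an additive homeomorphism `e : ↥𝔲 ≃ (Fin 3 → L⁺_v) × L⁺_v` and `c : Fin 3 → L⁺_v` with all `cᵢ ≠ 0` and
  **`disc χ_Y = ι(Σ cᵢ (e Y)ᵢ²)`**: diagonalise `H_w` over `L_w` (★ `Hermitian.exists_congr_diagonal_of_involution`), then ★ FILE A.
* §4 `lintegral_isCompact_sqrt_sqrt_normAbs_discr_inv_lt_top` — `∫⁻_C (√√|disc χ_Y|_{L_w})⁻¹ dμ𝔤 < ∞` on compacts: Haar transport along `e` (Mathlib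
  `AddEquiv.isAddHaarMeasure_map`, `isAddLeftInvariant_eq_smul`), `√√|ι Q|_{L_w} = √|Q|_{L⁺_v}`, a box, and ★ `lintegral_piPrimePowBall_sqrt_normAbs_inv_lt_top` (Weil's fibre
  density, `card = 3`) with Tate's `ψ_v` (★ `isContinuousNontrivial_adeleAddCharAt`) — the pattern of ★ `K2E3GL2DiscrInvSqrtLocallyIntegrable` §2.
* §5 **`locallyIntegrable_sqrt_sqrt_normAbs_discr_inv`** — THE HEAD, in the (L-B_U)′ currency: `LocallyIntegrable (fun Y ↦ ((√√|disc χ_Y|_{L_w})⁻¹ : ℝ)) μ𝔤`.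
[HarishChandra1999AdmissibleDistributions, Thm. 4.4 p. 11, §7 (rank one)] [Weil1965, Chap. III n° 36 Prop. 6] [Igusa1978, Ch. II §7] [NeukirchANT1999, Ch. II §4, §6].
HONEST LABEL: HC_CM is proved only modulo the 7 printed citations (2 remaining named inputs: hLiu418 = `stmt-HodgeConjecture-24832`, h413 = `stmt-HodgeConjecture-24833`)
until rung 0 closes; count-neutral helper ((L-B_U)′ itself still needs `J(𝒩)` on `𝔲₂` and the explicit `μ̂_𝒪`).

## References
* [HarishChandra1999AdmissibleDistributions] Harish-Chandra (DeBacker–Sally), *Admissible Invariant Distributions on Reductive p-adic Groups* (1999), Thm. 4.4, §7.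
* [Weil1965] A. Weil, *Sur la formule de Siegel dans la théorie des groupes classiques*, Acta Math. 113 (1965), Chap. III n° 36, Prop. 6.
* [Igusa1978] J.-I. Igusa, *Lectures on Forms of Higher Degree*, Tata Institute (1978), Ch. II §7.
* [NeukirchANT1999] J. Neukirch, *Algebraic Number Theory* (1999), Ch. II §4 Prop. (4.3), §6; Ch. I §8.
-/

set_option autoImplicit false
set_option linter.dupNamespace false   -- `Summit.HodgeConjecture.HodgeConjecture.…` (D-0017 nested layout; lakefile exemption for Summits)

noncomputable section

open MeasureTheory Measure Filter Topology Set NumberField IsDedekindDomain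
open scoped NNReal ENNReal Matrix
open Literature.NumberTheory.Automorphic Literature.NumberTheory.Automorphic.UnitaryGroup Literature.NumberTheory.Automorphic.LocalFieldHaar
open Literature.NumberTheory.GaloisRepresentations Literature.NumberTheory.GaloisRepresentations.IsNonarchimedeanLocalField
open Summit.HodgeConjecture.HodgeConjecture.Cruxes.H413.K2E3LieUnitary (lieOfForm mem_lieOfForm_iff isClosed_lieOfForm)
open Summit.HodgeConjecture.HodgeConjecture.Cruxes.H413.K2E3DiagonalFormInvSqrtIntegrable
open Summit.HodgeConjecture.HodgeConjecture.Cruxes.H413.K2E3U2LieDiagonalCoordinates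

namespace Summit.HodgeConjecture.HodgeConjecture.Cruxes.H413.K2E3U2DiscrInvFourthRootLocallyIntegrable

variable (L : Type) [Field L] [NumberField L] [IsCMField L] (v : HeightOneSpectrum (𝓞 ↥(maximalRealSubfield L)))
  (w : UnitaryGroup.PlacesOver L v) (hw : IsCMField.complexConj L • w.1 = w.1)

/-! ## §1  Continuous quadratic coordinates `L_w = ι(L⁺_v) ⊕ λ·ι(L⁺_v)` at a non-split place -/

include hw in
/-- **`L_w = ι(L⁺_v) ⊕ λ·ι(L⁺_v)` with continuous coordinates** at a non-split `w`: `λ = δ` (`cδ = −δ ≠ 0`, `σ_w λ = −λ`, `λ² = ι(δ²)`, `δ² ≠ 0`) and a continuous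
`ρ = (re, im) : L_w → L⁺_v × L⁺_v` with `z = ι(re z) + λ·ι(im z)` and `ρ(ι r + λ ι i) = (r, i)` — ★ `quadraticLocalEquiv` (`E ⊗_F F_v = F_v ⊕ F_v δ`) read at the single
place above `v` (Mathlib `Homeomorph.piUnique`). [cite: CasselsFrohlichANT1967, Ch. II §10] [cite: PlatonovRapinchuk1994, §5.1] -/
theorem exists_quadraticCoordinates :
    ∃ (lam : w.1.adicCompletion L) (d : v.adicCompletion ↥(maximalRealSubfield L))
      (ρ : w.1.adicCompletion L → v.adicCompletion ↥(maximalRealSubfield L) × v.adicCompletion ↥(maximalRealSubfield L)),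
      galAdicCompletionMap (L := L) (IsCMField.complexConj L) hw lam = -lam ∧ lam * lam = toPlace v w d ∧ d ≠ 0 ∧ Continuous ρ ∧
      (∀ z, toPlace v w (ρ z).1 + lam * toPlace v w (ρ z).2 = z) ∧ (∀ r i, ρ (toPlace v w r + lam * toPlace v w i) = (r, i)) := by
  classical
  haveI : Algebra.IsQuadraticExtension ↥(maximalRealSubfield L) L := IsCMField.isQuadraticExtension L
  have hc1 := IsCMField.complexConj_ne_one L
  obtain ⟨δ, hcδ, hδ⟩ := exists_apply_eq_neg_ne_zero (IsCMField.complexConj L) hc1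
  haveI : Subsingleton (PlacesOver L v) := PlacesOver.subsingleton_of_smul_eq (IsCMField.complexConj L) hc1 w hw
  letI : Unique (PlacesOver L v) := uniqueOfSubsingleton w
  -- the one place above `v`: `∏_{w' ∣ v} L_{w'} ≃ₜ L_w`
  let π : LocalRing L v ≃ₜ w.1.adicCompletion L := Homeomorph.piUnique fun w' : PlacesOver L v => w'.1.adicCompletion L
  have hπ : ∀ x : LocalRing L v, π x = x w := fun _ => rfl
  let q := quadraticLocalEquiv L v (IsCMField.complexConj L) hcδ hδ
  set lam : w.1.adicCompletion L := algebraMap L (w.1.adicCompletion L) δ with hlam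
  have hd2 : IsCMField.complexConj L (δ * δ) = δ * δ := by rw [map_mul, hcδ, neg_mul_neg]
  let d₀ : ↥(maximalRealSubfield L) := ⟨δ * δ, (IsCMField.complexConj_eq_self_iff L (δ * δ)).1 hd2⟩
  have hA : ∀ p : v.adicCompletion ↥(maximalRealSubfield L) × v.adicCompletion ↥(maximalRealSubfield L), π (q p) = toPlace v w p.1 + lam * toPlace v w p.2 := by
    intro p
    rw [hπ, quadraticLocalEquiv_apply, Pi.add_apply, Pi.mul_apply, toLocalRing_apply, toLocalRing_apply, Pi.algebraMap_apply, hlam]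
    ring
  have hcoe : ∀ x : L, algebraMap L (w.1.adicCompletion L) x = (x : w.1.adicCompletion L) := fun x => by
    rw [IsDedekindDomain.HeightOneSpectrum.algebraMap_adicCompletion, Function.comp_apply, Algebra.algebraMap_self, RingHom.id_apply]
  refine ⟨lam, (d₀ : v.adicCompletion ↥(maximalRealSubfield L)), fun z => q.symm (π.symm z), ?_, ?_, ?_, ?_, ?_, ?_⟩
  · rw [hlam, hcoe, galAdicCompletionMap_coe_algEquiv, hcδ, ← hcoe, ← hcoe, map_neg]
  · rw [toPlace_coe, hlam, ← map_mul]
    rw [IsDedekindDomain.HeightOneSpectrum.algebraMap_adicCompletion, Function.comp_apply, Algebra.algebraMap_self, RingHom.id_apply]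
    rfl
  · have hd0 : (d₀ : ↥(maximalRealSubfield L)) ≠ 0 := fun h => mul_ne_zero hδ hδ (congrArg Subtype.val h)
    exact fun h => hd0 ((map_eq_zero_iff (algebraMap ↥(maximalRealSubfield L) (v.adicCompletion ↥(maximalRealSubfield L))) (RingHom.injective _)).1
      (by rwa [IsDedekindDomain.HeightOneSpectrum.algebraMap_adicCompletion, Function.comp_apply, Algebra.algebraMap_self, RingHom.id_apply]))
  · exact q.symm.continuous.comp π.symm.continuous
  · intro z
    rw [← hA, ContinuousLinearEquiv.apply_symm_apply, Homeomorph.apply_symm_apply]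
  · intro r i
    have h : π.symm (toPlace v w r + lam * toPlace v w i) = q (r, i) := by
      rw [Homeomorph.symm_apply_eq, hA]
    show q.symm (π.symm (toPlace v w r + lam * toPlace v w i)) = (r, i)
    rw [h, ContinuousLinearEquiv.symm_apply_apply]

/-! ## §2  The scalar modulus `|ι y|_{L_w} = |y|_{L⁺_v}²` at a non-split place -/

include hw in
/-- **`|ι y|_{L_w} = |y|_{L⁺_v}²`** for the structure map `ι : L⁺_v → L_w` at a non-split place — `e(w|v) = 1`: `v_w(ι y) = v_v(y)`, `N𝔓_w = N𝔭_v²` (★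
`valued_toPlace_of_isUnramifiedIn`, ★ `absNorm_placesOver_eq_sq_of_nonsplit_of_isUnramifiedIn`); `e(w|v) = 2`: `v_w(ι y) = v_v(y)²`, `N𝔓_w = N𝔭_v` (★
`valued_toPlace_eq_pow_two_of_ramified`, ★ `absNorm_placesOver_eq_of_ramified`); `|x| = q^{−ord x}`. [cite: NeukirchANT1999, Ch. II §4 Prop. (4.3), §6; Ch. I §8] -/
theorem normAbs_toPlace_eq_sq (y : v.adicCompletion ↥(maximalRealSubfield L)) :
    normAbs (w.1.adicCompletion L) (toPlace v w y) = normAbs (v.adicCompletion ↥(maximalRealSubfield L)) y ^ 2 := by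
  haveI : Algebra.IsQuadraticExtension ↥(maximalRealSubfield L) L := IsCMField.isQuadraticExtension L
  have hc1 := IsCMField.complexConj_ne_one L
  by_cases hy : y = 0
  · rw [hy, map_zero, map_zero, map_zero, zero_pow two_ne_zero]
  have hv0 : Valued.v y ≠ 0 := (Valuation.ne_zero_iff _).2 hy
  have hyn : Valued.v y = WithZero.exp (Multiplicative.toAdd (WithZero.unzero hv0)) := by
    rw [WithZero.exp, ofAdd_toAdd, WithZero.coe_unzero]
  set n : ℤ := Multiplicative.toAdd (WithZero.unzero hv0) with hn
  have key : ∀ (a : ℝ≥0) (m : ℤ), (a ^ 2)⁻¹ ^ m = (a⁻¹ ^ m) ^ 2 := by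
    intro a m
    rw [← inv_pow, ← zpow_natCast, ← zpow_natCast, ← zpow_mul, ← zpow_mul, mul_comm]
  have key2 : ∀ (a : ℝ≥0) (m : ℤ), a⁻¹ ^ (-(2 * m)) = (a⁻¹ ^ (-m)) ^ 2 := by
    intro a m
    rw [← zpow_natCast, ← zpow_mul, show -m * ((2 : ℕ) : ℤ) = -(2 * m) by push_cast; ring]
  by_cases he : v.asIdeal.ramificationIdx' w.1.asIdeal = 1
  · -- unramified non-split
    have hunr : Algebra.IsUnramifiedIn (𝓞 L) v.asIdeal :=
      Liu2021.LemD1IndexedNonVacuityTameSynthesis.isUnramifiedIn_of_ramificationIdx'_eq_one L (IsCMField.complexConj L) v hc1 w hw he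
    have hwn : Valued.v (toPlace v w y) = WithZero.exp n :=
      (Liu2021.LemD1IndexedNonVacuityInertCofinite.valued_toPlace_of_isUnramifiedIn L v hunr w y).trans hyn
    rw [normAbs_eq_inv_zpow_of_valued_eq w.1 hwn, normAbs_eq_inv_zpow_of_valued_eq v hyn, residueFieldCard_adicCompletion_eq_absNorm,
      residueFieldCard_adicCompletion_eq_absNorm, Literature.NumberTheory.Rogawski1990.absNorm_placesOver_eq_sq_of_nonsplit_of_isUnramifiedIn L v w hw hunr,
      Nat.cast_pow]
    exact key _ _
  · -- ramified non-split
    have hwn : Valued.v (toPlace v w y) = WithZero.exp (2 * n) := by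
      rw [valued_toPlace_eq_pow_two_of_ramified (IsCMField.complexConj L) w hc1 hw he y, hyn, pow_two, ← WithZero.exp_add, two_mul]
    rw [normAbs_eq_inv_zpow_of_valued_eq w.1 hwn, normAbs_eq_inv_zpow_of_valued_eq v hyn, residueFieldCard_adicCompletion_eq_absNorm,
      residueFieldCard_adicCompletion_eq_absNorm, Literature.NumberTheory.Rogawski1990.absNorm_placesOver_eq_of_ramified L v w hw he]
    exact key2 _ _

/-! ## §3  Diagonal coordinates on `𝔲(σ_w, H_w)` and the discriminant -/

include hw in
/-- **Coordinates on `𝔲₂(H_w)` diagonalising the discriminant.**  For `H ∈ M₂(L)` hermitian with `det H ≠ 0` and `w` non-split there are an additive homeomorphism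
`e : ↥𝔲(σ_w, H_w) ≃ (Fin 3 → L⁺_v) × L⁺_v` and `c₀, c₁, c₂ ∈ L⁺_v ∖ {0}` with **`disc χ_Y = ι(c₀ (eY)₀² + c₁ (eY)₁² + c₂ (eY)₂²)`** for every `Y ∈ 𝔲`: diagonalise `H_w`
over `L_w` (★ `Hermitian.exists_congr_diagonal_of_involution`: `ᵗ(σP)·H_w·P = diag(a₀,a₁)`, `σ aᵢ = aᵢ ≠ 0`), descend `a₁∕a₀ = ι r` (★
`galAdicCompletionMap_eq_self_iff_mem_range`), and apply ★ FILE A (`𝔲(H_w) = P·𝔲(diag a)·P⁻¹`, `disc χ = ι(Λu² − 4r b₁² + 4rΛ b₂²)`).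
[cite: PlatonovRapinchuk1994, §2.3] [cite: HarishChandra1999AdmissibleDistributions, Thm. 7.5 p. 51] -/
theorem exists_addEquiv_discr_eq (H : Matrix (Fin 2) (Fin 2) L) (hH : (H.map (cmConjRingHom L))ᵀ = H) (hdet : H.det ≠ 0) :
    ∃ (e : ↥(lieOfForm (galAdicCompletionMap (L := L) (IsCMField.complexConj L) hw) (UnitaryGroup.placeForm H w.1)) ≃+
        ((Fin 3 → v.adicCompletion ↥(maximalRealSubfield L)) × v.adicCompletion ↥(maximalRealSubfield L)))
      (c : Fin 3 → v.adicCompletion ↥(maximalRealSubfield L)), Continuous e ∧ Continuous e.symm ∧ (∀ i, c i ≠ 0) ∧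
      ∀ Y : ↥(lieOfForm (galAdicCompletionMap (L := L) (IsCMField.complexConj L) hw) (UnitaryGroup.placeForm H w.1)),
        Y.1.charpoly.discr = toPlace v w (∑ i : Fin 3, c i * (e Y).1 i ^ 2) := by
  classical
  haveI : Algebra.IsQuadraticExtension ↥(maximalRealSubfield L) L := IsCMField.isQuadraticExtension L
  have hc1 := IsCMField.complexConj_ne_one L
  have hσσ : ∀ x, galAdicCompletionMap (L := L) (IsCMField.complexConj L) hw (galAdicCompletionMap (L := L) (IsCMField.complexConj L) hw x) = x :=
    galAdicCompletionMap_galAdicCompletionMap_of_smul_eq (IsCMField.complexConj L) w hc1 hw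
  have hσι : ∀ r, galAdicCompletionMap (L := L) (IsCMField.complexConj L) hw (toPlace v w r) = toPlace v w r := fun r =>
    (galAdicCompletionMap_eq_self_iff_mem_range (IsCMField.complexConj L) hc1 v w hw _).2 ⟨r, rfl⟩
  have h2 : (2 : w.1.adicCompletion L) ≠ 0 := two_ne_zero
  -- diagonalise `H_w`
  have hJ : (UnitaryGroup.placeForm H w.1)ᵀ.map (galAdicCompletionMap (L := L) (IsCMField.complexConj L) hw) = UnitaryGroup.placeForm H w.1 := by
    rw [← Matrix.transpose_map]
    exact Literature.NumberTheory.Rogawski1990.placeForm_map_transpose_of_hermitian L v w hw H hH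
  have hJdet : (UnitaryGroup.placeForm H w.1).det ≠ 0 := by
    rw [show UnitaryGroup.placeForm H w.1 = (algebraMap L (w.1.adicCompletion L)).mapMatrix H from rfl, ← RingHom.map_det]
    exact (map_ne_zero _).2 hdet
  obtain ⟨P, hPdet, a, ha, ha0, hPJP⟩ := Literature.NumberTheory.QuadraticForms.Hermitian.exists_congr_diagonal_of_involution hσσ
    ⟨1, by rw [map_one, one_add_one_eq_two]; exact h2⟩ (UnitaryGroup.placeForm H w.1) hJ hJdet
  have hPu : IsUnit P := (Matrix.isUnit_iff_isUnit_det P).2 hPdet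
  -- descend `a₁ ∕ a₀`
  obtain ⟨r, hr⟩ := (galAdicCompletionMap_eq_self_iff_mem_range (IsCMField.complexConj L) hc1 v w hw (a 1 / a 0)).1 (by rw [map_div₀, ha, ha])
  have hr' : toPlace v w r = a 1 / a 0 := hr
  have hr0 : r ≠ 0 := by
    intro h
    rw [h, map_zero] at hr'
    exact div_ne_zero (ha0 1) (ha0 0) hr'.symm
  -- quadratic coordinates and FILE A
  obtain ⟨lam, d, ρ, hσl, hll, hd0, hρc, hρ1, hρ2⟩ := exists_quadraticCoordinates L v w hw
  obtain ⟨eD, heD, heDs, hdisc⟩ := exists_addEquiv_lieOfForm_diagonal (galAdicCompletionMap (L := L) (IsCMField.complexConj L) hw) (toPlace v w)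
    (continuous_toPlace v w) lam ρ hρc hρ1 hρ2 hσι hσl h2 a ha0 r d hr' hll
  have hD : Matrix.diagonal a = ((hPu.unit : Matrix (Fin 2) (Fin 2) (w.1.adicCompletion L)).map
      (galAdicCompletionMap (L := L) (IsCMField.complexConj L) hw))ᵀ * UnitaryGroup.placeForm H w.1 * (hPu.unit : Matrix (Fin 2) (Fin 2) (w.1.adicCompletion L)) := by
    rw [IsUnit.unit_spec, ← Matrix.transpose_map]
    exact hPJP.symm
  -- transport along `Y ↦ P⁻¹ Y P`
  have key : ∀ D : Matrix (Fin 2) (Fin 2) (w.1.adicCompletion L),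
      D = ((hPu.unit : Matrix (Fin 2) (Fin 2) (w.1.adicCompletion L)).map (galAdicCompletionMap (L := L) (IsCMField.complexConj L) hw))ᵀ *
        UnitaryGroup.placeForm H w.1 * (hPu.unit : Matrix (Fin 2) (Fin 2) (w.1.adicCompletion L)) →
      (∃ eD : ↥(lieOfForm (galAdicCompletionMap (L := L) (IsCMField.complexConj L) hw) D) ≃+
          ((Fin 3 → v.adicCompletion ↥(maximalRealSubfield L)) × v.adicCompletion ↥(maximalRealSubfield L)), Continuous eD ∧ Continuous eD.symm ∧
        ∀ X : ↥(lieOfForm (galAdicCompletionMap (L := L) (IsCMField.complexConj L) hw) D),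
          X.1.charpoly.discr = toPlace v w (∑ i : Fin 3, (![d, -4 * r, 4 * r * d] i) * (eD X).1 i ^ 2)) →
      ∃ (e : ↥(lieOfForm (galAdicCompletionMap (L := L) (IsCMField.complexConj L) hw) (UnitaryGroup.placeForm H w.1)) ≃+
          ((Fin 3 → v.adicCompletion ↥(maximalRealSubfield L)) × v.adicCompletion ↥(maximalRealSubfield L))),
        Continuous e ∧ Continuous e.symm ∧
        ∀ Y : ↥(lieOfForm (galAdicCompletionMap (L := L) (IsCMField.complexConj L) hw) (UnitaryGroup.placeForm H w.1)),
          Y.1.charpoly.discr = toPlace v w (∑ i : Fin 3, (![d, -4 * r, 4 * r * d] i) * (e Y).1 i ^ 2) := by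
    rintro D rfl ⟨eD, heD, heDs, hdisc⟩
    obtain ⟨e', he', he's, hcorr⟩ := exists_addEquiv_lieOfForm_of_congr (galAdicCompletionMap (L := L) (IsCMField.complexConj L) hw) hPu.unit
      (UnitaryGroup.placeForm H w.1) eD heD heDs
    refine ⟨e', he', he's, fun Y => ?_⟩
    obtain ⟨X, hYX, hch⟩ := hcorr Y
    rw [← hch, hdisc X, hYX]
  obtain ⟨e, he, hes, hdisc'⟩ := key (Matrix.diagonal a) hD ⟨eD, heD, heDs, hdisc⟩
  refine ⟨e, ![d, -4 * r, 4 * r * d], he, hes, fun i => ?_, hdisc'⟩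
  fin_cases i
  · exact hd0
  · exact mul_ne_zero (neg_ne_zero.2 (by norm_num)) hr0
  · exact mul_ne_zero (mul_ne_zero (by norm_num) hr0) hd0

/-! ## §4  `∫⁻_C (√√|disc χ_Y|_{L_w})⁻¹ dμ𝔤 < ∞` on compact sets -/

set_option maxHeartbeats 1600000 in
include hw in
/-- **`∫⁻_C (√√|disc χ_Y|_{L_w})⁻¹ dμ𝔤 < ∞` for every compact `C ⊂ 𝔲₂(H_w)`** (`w` non-split, `μ𝔤` any additive Haar measure on `↥𝔲`): transport along the coordinates
`e` of §3 (Mathlib `AddEquiv.isAddHaarMeasure_map`, Haar uniqueness `isAddLeftInvariant_eq_smul`), `√√|ι Q|_{L_w} = √|Q|_{L⁺_v}` (§2), a box `(𝔭^{−n})³ × 𝔭^{−n} ⊇ e(C)`, and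
★ `lintegral_piPrimePowBall_sqrt_normAbs_inv_lt_top` (Weil's fibre density; `ψ_v` = Tate's character ★ `isContinuousNontrivial_adeleAddCharAt`).
[cite: Weil1965, Chap. III n° 36 Prop. 6, p. 54] [cite: HarishChandra1999AdmissibleDistributions, Thm. 4.4 p. 11] -/
theorem lintegral_isCompact_sqrt_sqrt_normAbs_discr_inv_lt_top (H : Matrix (Fin 2) (Fin 2) L) (hH : (H.map (cmConjRingHom L))ᵀ = H) (hdet : H.det ≠ 0)
    [MeasurableSpace ↥(lieOfForm (galAdicCompletionMap (L := L) (IsCMField.complexConj L) hw) (UnitaryGroup.placeForm H w.1))]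
    [BorelSpace ↥(lieOfForm (galAdicCompletionMap (L := L) (IsCMField.complexConj L) hw) (UnitaryGroup.placeForm H w.1))]
    (μ𝔤 : Measure ↥(lieOfForm (galAdicCompletionMap (L := L) (IsCMField.complexConj L) hw) (UnitaryGroup.placeForm H w.1))) [μ𝔤.IsAddHaarMeasure]
    {C : Set ↥(lieOfForm (galAdicCompletionMap (L := L) (IsCMField.complexConj L) hw) (UnitaryGroup.placeForm H w.1))} (hC : IsCompact C) :
    ∫⁻ Y in C, (((NNReal.sqrt (NNReal.sqrt (normAbs (w.1.adicCompletion L) Y.1.charpoly.discr)))⁻¹ : ℝ≥0) : ℝ≥0∞) ∂μ𝔤 < ∞ := by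
  classical
  -- the base local field `F = L⁺_v`, its Haar measure and Tate's character
  haveI : T2Space (v.adicCompletion ↥(maximalRealSubfield L)) := (isLocalField (v.adicCompletion ↥(maximalRealSubfield L))).toT2Space
  haveI : LocallyCompactSpace (v.adicCompletion ↥(maximalRealSubfield L)) := (isLocalField (v.adicCompletion ↥(maximalRealSubfield L))).toLocallyCompactSpace
  haveI : SecondCountableTopology (v.adicCompletion ↥(maximalRealSubfield L)) := secondCountableTopology_localField _
  letI mF : MeasurableSpace (v.adicCompletion ↥(maximalRealSubfield L)) := borel _
  haveI : BorelSpace (v.adicCompletion ↥(maximalRealSubfield L)) := ⟨rfl⟩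
  set μ : Measure (v.adicCompletion ↥(maximalRealSubfield L)) := Measure.addHaar with hμ
  have hψ := isContinuousNontrivial_adeleAddCharAt ↥(maximalRealSubfield L) v
  have h2F : (2 : v.adicCompletion ↥(maximalRealSubfield L)) ≠ 0 := two_ne_zero
  -- coordinates
  obtain ⟨eA, c, he, hesymm, hc0, hdisc⟩ := exists_addEquiv_discr_eq L v w hw H hH hdet
  let eH : ↥(lieOfForm (galAdicCompletionMap (L := L) (IsCMField.complexConj L) hw) (UnitaryGroup.placeForm H w.1)) ≃ₜ
      ((Fin 3 → v.adicCompletion ↥(maximalRealSubfield L)) × v.adicCompletion ↥(maximalRealSubfield L)) := Homeomorph.mk eA.toEquiv he hesymm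
  let em := eH.toMeasurableEquiv
  have hem : ∀ Y, em Y = eA Y := fun Y => rfl
  haveI : (μ𝔤.map eA).IsAddHaarMeasure := AddEquiv.isAddHaarMeasure_map μ𝔤 eA he hesymm
  set ν₀ : Measure ((Fin 3 → v.adicCompletion ↥(maximalRealSubfield L)) × v.adicCompletion ↥(maximalRealSubfield L)) := (Measure.pi fun _ : Fin 3 => μ).prod μ with hν₀
  haveI : ν₀.IsAddHaarMeasure := by rw [hν₀]; infer_instance
  have hsmul : μ𝔤.map eA = addHaarScalarFactor (μ𝔤.map eA) ν₀ • ν₀ := isAddLeftInvariant_eq_smul _ _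
  -- the image of `C` lies in a box
  have hCc : IsCompact (eA '' C) := hC.image he
  obtain ⟨n₀, hn₀⟩ : ∃ n : ℕ, eA '' C ⊆ piPrimePowBall (v.adicCompletion ↥(maximalRealSubfield L)) (Fin 3) (-(n : ℤ)) ×ˢ
      primePowBall (v.adicCompletion ↥(maximalRealSubfield L)) (-(n : ℤ)) := by
    have hcover : eA '' C ⊆ ⋃ n : ℕ, piPrimePowBall (v.adicCompletion ↥(maximalRealSubfield L)) (Fin 3) (-(n : ℤ)) ×ˢ
        primePowBall (v.adicCompletion ↥(maximalRealSubfield L)) (-(n : ℤ)) := by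
      intro z _
      obtain ⟨k₁, hk₁⟩ := exists_mem_piPrimePowBall z.1
      obtain ⟨k₂, hk₂⟩ := exists_mem_piPrimePowBall (fun _ : Fin 1 => z.2)
      refine Set.mem_iUnion.2 ⟨max k₁ k₂, Set.mk_mem_prod (piPrimePowBall_antitone (by omega) hk₁) ?_⟩
      exact primePowBall_antitone (by omega) (mem_piPrimePowBall_iff.1 hk₂ 0)
    have hdir : Directed (· ⊆ ·) fun n : ℕ => piPrimePowBall (v.adicCompletion ↥(maximalRealSubfield L)) (Fin 3) (-(n : ℤ)) ×ˢ
        primePowBall (v.adicCompletion ↥(maximalRealSubfield L)) (-(n : ℤ)) :=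
      Monotone.directed_le fun a b hab => Set.prod_mono (piPrimePowBall_antitone (by omega)) (primePowBall_antitone (by omega))
    exact hCc.elim_directed_cover _ (fun n => (isOpen_piPrimePowBall _).prod (isOpen_primePowBall _)) hcover hdir
  set Bx : Set ((Fin 3 → v.adicCompletion ↥(maximalRealSubfield L)) × v.adicCompletion ↥(maximalRealSubfield L)) :=
    piPrimePowBall (v.adicCompletion ↥(maximalRealSubfield L)) (Fin 3) (-(n₀ : ℤ)) ×ˢ primePowBall (v.adicCompletion ↥(maximalRealSubfield L)) (-(n₀ : ℤ)) with hBx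
  have hBxm : MeasurableSet Bx := (measurableSet_piPrimePowBall _).prod (measurableSet_primePowBall _)
  -- the weight in coordinates: `√√|ι Q|_{L_w} = √|Q|_{L⁺_v}`
  set W : ((Fin 3 → v.adicCompletion ↥(maximalRealSubfield L)) × v.adicCompletion ↥(maximalRealSubfield L)) → ℝ≥0∞ :=
    fun z => (((NNReal.sqrt (normAbs (v.adicCompletion ↥(maximalRealSubfield L)) (∑ i, c i * z.1 i ^ 2)))⁻¹ : ℝ≥0) : ℝ≥0∞) with hW
  have hWe : ∀ Y, W (eA Y) = (((NNReal.sqrt (NNReal.sqrt (normAbs (w.1.adicCompletion L) Y.1.charpoly.discr)))⁻¹ : ℝ≥0) : ℝ≥0∞) := by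
    intro Y
    rw [hdisc Y, normAbs_toPlace_eq_sq L v w hw, NNReal.sqrt_sq]
  have hQc : Continuous fun z : (Fin 3 → v.adicCompletion ↥(maximalRealSubfield L)) × v.adicCompletion ↥(maximalRealSubfield L) => ∑ i, c i * z.1 i ^ 2 :=
    continuous_finsetSum _ fun i _ => continuous_const.mul (((continuous_apply i).comp continuous_fst).pow 2)
  have hWm : Measurable W :=
    ENNReal.continuous_coe.measurable.comp ((NNReal.continuous_sqrt.comp (continuous_normAbs.comp hQc)).measurable.inv)
  -- transport
  have hstep1 : ∫⁻ Y in C, (((NNReal.sqrt (NNReal.sqrt (normAbs (w.1.adicCompletion L) Y.1.charpoly.discr)))⁻¹ : ℝ≥0) : ℝ≥0∞) ∂μ𝔤 =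
      ∫⁻ z, (eA '' C).indicator W z ∂(μ𝔤.map eA) := by
    rw [show (μ𝔤.map eA) = μ𝔤.map em from rfl, lintegral_map_equiv, ← lintegral_indicator hC.measurableSet]
    refine lintegral_congr fun Y => ?_
    rw [hem]
    by_cases hY : Y ∈ C
    · rw [Set.indicator_of_mem hY, Set.indicator_of_mem (Set.mem_image_of_mem _ hY), hWe]
    · rw [Set.indicator_of_notMem hY, Set.indicator_of_notMem (fun h => hY ?_)]
      obtain ⟨Y', hY', hYY'⟩ := h
      rwa [← eA.injective hYY']
  rw [hstep1, hsmul, lintegral_smul_measure]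
  refine ENNReal.mul_lt_top ENNReal.coe_lt_top ?_
  calc ∫⁻ z, (eA '' C).indicator W z ∂ν₀ ≤ ∫⁻ z, Bx.indicator W z ∂ν₀ := lintegral_mono fun z => Set.indicator_le_indicator_of_subset hn₀ (fun _ => zero_le) z
    _ = ∫⁻ z in Bx, W z ∂ν₀ := lintegral_indicator hBxm _
    _ = (∫⁻ x in piPrimePowBall (v.adicCompletion ↥(maximalRealSubfield L)) (Fin 3) (-(n₀ : ℤ)),
            (((NNReal.sqrt (normAbs (v.adicCompletion ↥(maximalRealSubfield L)) (∑ i, c i * x i ^ 2)))⁻¹ : ℝ≥0) : ℝ≥0∞) ∂(Measure.pi fun _ : Fin 3 => μ)) *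
          μ (primePowBall (v.adicCompletion ↥(maximalRealSubfield L)) (-(n₀ : ℤ))) := by
        rw [hBx, hν₀, ← Measure.prod_restrict]
        have hfm : Measurable fun x : Fin 3 → v.adicCompletion ↥(maximalRealSubfield L) =>
            (((NNReal.sqrt (normAbs (v.adicCompletion ↥(maximalRealSubfield L)) (∑ i, c i * x i ^ 2)))⁻¹ : ℝ≥0) : ℝ≥0∞) :=
          ENNReal.continuous_coe.measurable.comp ((NNReal.continuous_sqrt.comp (continuous_normAbs.comp
            (continuous_finsetSum _ fun i _ => continuous_const.mul ((continuous_apply i).pow 2)))).measurable.inv)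
        have h := lintegral_prod_mul (μ := (Measure.pi fun _ : Fin 3 => μ).restrict (piPrimePowBall (v.adicCompletion ↥(maximalRealSubfield L)) (Fin 3) (-(n₀ : ℤ))))
          (ν := μ.restrict (primePowBall (v.adicCompletion ↥(maximalRealSubfield L)) (-(n₀ : ℤ))))
          (f := fun x : Fin 3 → v.adicCompletion ↥(maximalRealSubfield L) =>
            (((NNReal.sqrt (normAbs (v.adicCompletion ↥(maximalRealSubfield L)) (∑ i, c i * x i ^ 2)))⁻¹ : ℝ≥0) : ℝ≥0∞)) (g := fun _ => 1)
          hfm.aemeasurable aemeasurable_const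
        simp only [mul_one, lintegral_const, Measure.restrict_apply_univ, one_mul] at h
        exact h
    _ < ∞ := ENNReal.mul_lt_top (lintegral_piPrimePowBall_sqrt_normAbs_inv_lt_top μ hψ h2F hc0 (by simp) _) (measure_primePowBall_lt_top μ _)

/-! ## §5  The head: local integrability of `(√√|disc χ_Y|_{L_w})⁻¹` on `𝔲₂(H_w)` -/

include hw in
/-- **`Y ↦ |disc χ_Y|_{L_w}^{-1∕4}` IS LOCALLY INTEGRABLE ON `𝔲₂(H_w)`** (`w` non-split — inert or ramified, any residue characteristic; `H ∈ M₂(L)` hermitian,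
`det H ≠ 0`; `μ𝔤` any additive Haar measure on `↥𝔲(σ_w, H_w)`; the weight vanishes on the singular locus).  The `N = 2` integrability input of the hosted socket
(L-B_U)′ `sig_K2E3UNilpotentFourierRegular` (weight token `NNReal.sqrt (NNReal.sqrt (normAbs (w.1.adicCompletion L) Y.1.charpoly.discr))`).
[cite: HarishChandra1999AdmissibleDistributions, Thm. 4.4 p. 11, §7 Thm. 7.5 p. 51] [cite: Weil1965, Chap. III n° 36 Prop. 6] [cite: Igusa1978, Ch. II §7 Thm. 1] -/
theorem locallyIntegrable_sqrt_sqrt_normAbs_discr_inv (H : Matrix (Fin 2) (Fin 2) L) (hH : (H.map (cmConjRingHom L))ᵀ = H) (hdet : H.det ≠ 0)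
    [MeasurableSpace ↥(lieOfForm (galAdicCompletionMap (L := L) (IsCMField.complexConj L) hw) (UnitaryGroup.placeForm H w.1))]
    [BorelSpace ↥(lieOfForm (galAdicCompletionMap (L := L) (IsCMField.complexConj L) hw) (UnitaryGroup.placeForm H w.1))]
    (μ𝔤 : Measure ↥(lieOfForm (galAdicCompletionMap (L := L) (IsCMField.complexConj L) hw) (UnitaryGroup.placeForm H w.1))) [μ𝔤.IsAddHaarMeasure] :
    LocallyIntegrable (fun Y : ↥(lieOfForm (galAdicCompletionMap (L := L) (IsCMField.complexConj L) hw) (UnitaryGroup.placeForm H w.1)) =>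
      (((NNReal.sqrt (NNReal.sqrt (normAbs (w.1.adicCompletion L) Y.1.charpoly.discr)))⁻¹ : ℝ≥0) : ℝ)) μ𝔤 := by
  haveI : T2Space (w.1.adicCompletion L) := (isLocalField (w.1.adicCompletion L)).toT2Space
  haveI : LocallyCompactSpace (w.1.adicCompletion L) := (isLocalField (w.1.adicCompletion L)).toLocallyCompactSpace
  haveI : LocallyCompactSpace (Matrix (Fin 2) (Fin 2) (w.1.adicCompletion L)) := Pi.locallyCompactSpace_of_finite
  haveI : LocallyCompactSpace ↥(lieOfForm (galAdicCompletionMap (L := L) (IsCMField.complexConj L) hw) (UnitaryGroup.placeForm H w.1)) :=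
    (Topology.IsClosedEmbedding.subtypeVal (isClosed_lieOfForm (σ := galAdicCompletionMap (L := L) (IsCMField.complexConj L) hw)
      (J := UnitaryGroup.placeForm H w.1) (continuous_galAdicCompletionMap L (IsCMField.complexConj L) hw))).locallyCompactSpace
  have hmeas : Measurable fun Y : ↥(lieOfForm (galAdicCompletionMap (L := L) (IsCMField.complexConj L) hw) (UnitaryGroup.placeForm H w.1)) =>
      (((NNReal.sqrt (NNReal.sqrt (normAbs (w.1.adicCompletion L) Y.1.charpoly.discr)))⁻¹ : ℝ≥0) : ℝ) :=
    measurable_coe_nnreal_real.comp ((NNReal.continuous_sqrt.comp (NNReal.continuous_sqrt.comp (continuous_normAbs.comp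
      (K2E3NormalizedCharBddNearSemisimpleRegular.continuous_discr_charpoly.comp continuous_subtype_val)))).measurable.inv)
  rw [locallyIntegrable_iff]
  intro C hC
  refine ⟨hmeas.aestronglyMeasurable.restrict, ?_⟩
  rw [hasFiniteIntegral_iff_enorm]
  have h := lintegral_isCompact_sqrt_sqrt_normAbs_discr_inv_lt_top L v w hw H hH hdet μ𝔤 hC
  refine lt_of_le_of_lt (le_of_eq (lintegral_congr fun Y => ?_)) h
  rw [Real.enorm_eq_ofReal (NNReal.coe_nonneg _), ENNReal.ofReal_coe_nnreal]

end Summit.HodgeConjecture.HodgeConjecture.Cruxes.H413.K2E3U2DiscrInvFourthRootLocallyIntegrable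

end
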